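import Summits.CriticalPhenomena.PercolationContinuityZ3.Theorems.PercNearOneGluingNoHeavyLowerTailQuantitativeSeparatorMoments
import HarnessLib

/-!
# The SEPARATOR IDENTITIES (BENCH row M2-R54, PROOFS §P54 (a)): `Cov = λ_Rφ_L + λ_Lφ_R + λ_Lλ_R·E T`, `Cov − M = φ_Lφ_R`

Support file (`--supports stmt-CriticalPhenomena-4575`), prover seat `prim-rate-mine-2` (lane prim-rate, constants-miner (c);
`run/shared/lean/prim/prim-rate/prim-rate-mine-2/PROOFS.md` §P54 (a); BENCH row l.192 M2-R54, signed mine-ref-g54).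
No definitions, no named facts, no sorries; standard axioms.

SETTING (the SEPARATOR CLASS).  Independent bond percolation with pair weights `w` on a finite vertex type `V`; vertices
`x ≠ a` (the root and the pinned vertex), a set `L` of vertices with `x, a ∉ L`, `b ∈ L` and `u ∉ L ∪ {x,a}`, and NO positive
weight across: every pair which is neither inside `L ∪ {x,a}` (the `L`-side, `KNSep.sideB L {x,a}`, which contains the pair
`{x,a}`) nor inside `(L ∪ {x,a})ᶜ ∪ {x,a}` minus the pairs inside `{x,a}` (the `R`-side, `KNSep.sideT L {x,a}`) has weight `0`.
Events: `T = {x↔a}`, `F = {x↔b}`, `G = {x↔u}`; `Cov = μ(F∩G) − μ(F)μ(G)`,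
`M = μ(T∩F∩G) + μ(T)μ(F∩G) − μ(F)μ(T∩G) − μ(G)μ(T∩F)` (the first-order one-pair bracket, `c = −M/Cov`).
SIDE STATISTICS (connectivity INSIDE a side: `↔_L` = joined by open pairs of the `L`-side, `↔_R` likewise):
`λ_L = μ(a ↔_L b, x ↮_L b)`, `φ_L = μ(x ↔_L a ∧ (x ↔_L b ∨ a ↔_L b)) − μ(x ↔_L a)·μ(x ↔_L b ∨ a ↔_L b)`, and `λ_R`, `φ_R` with `u`.

* structure (part 1, `…QuantitativeSeparatorStructure`) and the moments `μ(T)`, `μ(F)`, `μ(G)`, `μ(TF)`, `μ(TG)` (part 2, `…QuantitativeSeparatorMoments`);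
* this file: `μ(F∩G)`, `μ(T∩F∩G)` (`CSH.sep_real_FG`, `sep_real_TFG`), the side covariances in the atoms (`sep_real_sideL/R`), and
* **`CSH.sep_cov_eq`** — (I1) `Cov = λ_R·φ_L + λ_L·φ_R + λ_L·λ_R·μ(T)`;
* **`CSH.sep_cov_sub_bracket_eq`** — (I2) `Cov − M = φ_L·φ_R` (so `1 + c = φ_Lφ_R/Cov ≥ 0` on the class).
With the ONE-SIDE SIZE LEMMA (`CSH.oneSideCov_le_count_mul`, file `…QuantitativeOneSideSizeLemma`) these give the SIZE LAW
`c ≤ |L||R|/(|L|+|R|+μ(T)) − 1` on the whole separator class (PROOFS §P56 (C1); assembled in a separate file).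
[cite: VandenbergHaggstromKahn2005, Thm. 1.3 (p. 6)] [cite: KozmaNitzan2024, proof of Thm. 3 (pp. 10–11)]
-/


noncomputable section

namespace Summit.CriticalPhenomena.PercolationContinuityZ3.Theorems.CSH

open MeasureTheory Set unitInterval
open Literature.Probability.LatticeModels (prodBernoulli)
open Literature.Probability.Percolation
open Literature.Probability.Percolation.KNSep
open scoped Classical

variable {V : Type*}

/-! ### The last two moments and the identities -/

section Moments

variable [Fintype V]
variable (w : Sym2 V → unitInterval) (L : Set V) (x a b u : V)

variable {L x a b u}
variable (hx : x ∉ L) (ha : a ∉ L) (hxa : x ≠ a) (hb : b ∈ L) (hu : u ∉ L)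
  (hcut : ∀ e, e ∉ sideB L ({x, a} : Set V) → e ∉ sideT L ({x, a} : Set V) → w e = 0)
include hx ha hxa hb hu hcut



/-- `μ(F ∩ G) = ξξ' + κ λ_R + λ_L κ'`. [folklore] -/
theorem sep_real_FG : (prodBernoulli w).real (openConn x b ∩ openConn x u) =
    (prodBernoulli w).real (({ω : BondConfig V | rB L {x, a} ω x b} : Set (BondConfig V))) * (prodBernoulli w).real (({ω : BondConfig V | (openGraph (ω ∩ sideT L {x,
          a})).Reachable x u} : Set (BondConfig V))) +
      (prodBernoulli w).real ((({ω : BondConfig V | rB L {x, a} ω x a} : Set (BondConfig V))) ∩ (({ω : BondConfig V | rB L {x, a} ω x b} : Set (BondConfig V)))) * (prodBernoulli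
            w).real ((({ω : BondConfig V | (openGraph (ω ∩ sideT L {x, a})).Reachable a u} : Set (BondConfig V)) ∩ ({ω : BondConfig V | (openGraph (ω ∩ sideT L {x, a})).Reachable
            x u} : Set (BondConfig V))ᶜ)) +
      (prodBernoulli w).real ((({ω : BondConfig V | rB L {x, a} ω a b} : Set (BondConfig V)) ∩ ({ω : BondConfig V | rB L {x, a} ω x b} : Set (BondConfig V))ᶜ)) * (prodBernoulli
            w).real ((({ω : BondConfig V | (openGraph (ω ∩ sideT L {x, a})).Reachable x a} : Set (BondConfig V))) ∩ (({ω : BondConfig V | (openGraph (ω ∩ sideT L {x,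
            a})).Reachable x u} : Set (BondConfig V)))) := by
  have h1 : (prodBernoulli w).real (openConn x b ∩ openConn x u) =
      (prodBernoulli w).real ((((({ω : BondConfig V | rB L {x, a} ω x b} : Set (BondConfig V))) ∩ (({ω : BondConfig V | (openGraph (ω ∩ sideT L {x, a})).Reachable x u} : Set
            (BondConfig V)))) ∪ (((({ω : BondConfig V | rB L {x, a} ω x a} : Set (BondConfig V))) ∩ (({ω : BondConfig V | rB L {x, a} ω x b} : Set (BondConfig V)))) ∩ ((({ω :
            BondConfig V | (openGraph (ω ∩ sideT L {x, a})).Reachable a u} : Set (BondConfig V)) ∩ ({ω : BondConfig V | (openGraph (ω ∩ sideT L {x, a})).Reachable x u} : Set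
            (BondConfig V))ᶜ)))) ∪ (((({ω : BondConfig V | rB L {x, a} ω a b} : Set (BondConfig V)) ∩ ({ω : BondConfig V | rB L {x, a} ω x b} : Set (BondConfig V))ᶜ)) ∩ ((({ω :
            BondConfig V | (openGraph (ω ∩ sideT L {x, a})).Reachable x a} : Set (BondConfig V))) ∩ (({ω : BondConfig V | (openGraph (ω ∩ sideT L {x, a})).Reachable x u} : Set
            (BondConfig V)))))) :=
    sep_real_congr w fun ω hω => by
      obtain ⟨-, hF, hG, htL, -⟩ := sep_structure w hx ha hxa hb hu hcut hω
      simp only [openConn, Set.mem_setOf_eq, Set.mem_union, Set.mem_inter_iff, Set.mem_compl_iff] at hF hG ⊢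
      rw [hF, hG]
      constructor
      · rintro ⟨h1 | ⟨hB, hX, hA'⟩, h2 | ⟨hB', hX', hA⟩⟩
        · exact Or.inl (Or.inl ⟨h1, h2⟩)
        · exact Or.inl (Or.inr ⟨⟨hA, h1⟩, hB', hX'⟩)
        · exact Or.inr ⟨⟨hB, hX⟩, hA', h2⟩
        · exact absurd (htL hA hB) hX
      · rintro ((⟨h1, h2⟩ | ⟨⟨hA, h1⟩, hB', hX'⟩) | ⟨⟨hB, hX⟩, hA', h2⟩)
        · exact ⟨Or.inl h1, Or.inl h2⟩
        · exact ⟨Or.inl h1, Or.inr ⟨hB', hX', hA⟩⟩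
        · exact ⟨Or.inr ⟨hB, hX, hA'⟩, Or.inl h2⟩
  have hd1 : Disjoint ((({ω : BondConfig V | rB L {x, a} ω x b} : Set (BondConfig V))) ∩ (({ω : BondConfig V | (openGraph (ω ∩ sideT L {x, a})).Reachable x u} : Set (BondConfig
        V)))) (((({ω : BondConfig V | rB L {x, a} ω x a} : Set (BondConfig V))) ∩ (({ω : BondConfig V | rB L {x, a} ω x b} : Set (BondConfig V)))) ∩ ((({ω : BondConfig V |
        (openGraph (ω ∩ sideT L {x, a})).Reachable a u} : Set (BondConfig V)) ∩ ({ω : BondConfig V | (openGraph (ω ∩ sideT L {x, a})).Reachable x u} : Set (BondConfig V))ᶜ))) :=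
        Set.disjoint_left.2 fun ω h1 h2 => h2.2.2 h1.2
  have hd2 : Disjoint (((({ω : BondConfig V | rB L {x, a} ω x b} : Set (BondConfig V))) ∩ (({ω : BondConfig V | (openGraph (ω ∩ sideT L {x, a})).Reachable x u} : Set (BondConfig
        V)))) ∪ (((({ω : BondConfig V | rB L {x, a} ω x a} : Set (BondConfig V))) ∩ (({ω : BondConfig V | rB L {x, a} ω x b} : Set (BondConfig V)))) ∩ ((({ω : BondConfig V |
        (openGraph (ω ∩ sideT L {x, a})).Reachable a u} : Set (BondConfig V)) ∩ ({ω : BondConfig V | (openGraph (ω ∩ sideT L {x, a})).Reachable x u} : Set (BondConfig V))ᶜ))))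
        (((({ω : BondConfig V | rB L {x, a} ω a b} : Set (BondConfig V)) ∩ ({ω : BondConfig V | rB L {x, a} ω x b} : Set (BondConfig V))ᶜ)) ∩ ((({ω : BondConfig V | (openGraph (ω
        ∩ sideT L {x, a})).Reachable x a} : Set (BondConfig V))) ∩ (({ω : BondConfig V | (openGraph (ω ∩ sideT L {x, a})).Reachable x u} : Set (BondConfig V))))) :=
        Set.disjoint_left.2 fun ω h1 h2 => by
    rcases h1 with h1 | h1
    · exact h2.1.2 h1.1
    · exact h2.1.2 h1.1.2
  have i1 := sep_indep w L x a (fun η => (openGraph η).Reachable x b)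
      (fun η => (openGraph η).Reachable x u) (S := (({ω : BondConfig V | rB L {x, a} ω x b} : Set (BondConfig V)))) (S' := (({ω : BondConfig V | (openGraph (ω ∩ sideT L {x,
            a})).Reachable x u} : Set (BondConfig V)))) rfl rfl
  have i2 := sep_indep w L x a (fun η => (openGraph η).Reachable x a ∧ (openGraph η).Reachable x b)
      (fun η => (openGraph η).Reachable a u ∧ ¬ (openGraph η).Reachable x u) (S := (({ω : BondConfig V | rB L {x, a} ω x a} : Set (BondConfig V))) ∩ (({ω : BondConfig V | rB L {x,
            a} ω x b} : Set (BondConfig V)))) (S' := ((({ω : BondConfig V | (openGraph (ω ∩ sideT L {x, a})).Reachable a u} : Set (BondConfig V)) ∩ ({ω : BondConfig V | (openGraph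
            (ω ∩ sideT L {x, a})).Reachable x u} : Set (BondConfig V))ᶜ))) rfl rfl
  have i3 := sep_indep w L x a (fun η => (openGraph η).Reachable a b ∧ ¬ (openGraph η).Reachable x b)
      (fun η => (openGraph η).Reachable x a ∧ (openGraph η).Reachable x u) (S := ((({ω : BondConfig V | rB L {x, a} ω a b} : Set (BondConfig V)) ∩ ({ω : BondConfig V | rB L {x, a}
            ω x b} : Set (BondConfig V))ᶜ))) (S' := (({ω : BondConfig V | (openGraph (ω ∩ sideT L {x, a})).Reachable x a} : Set (BondConfig V))) ∩ (({ω : BondConfig V | (openGraph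
            (ω ∩ sideT L {x, a})).Reachable x u} : Set (BondConfig V)))) rfl rfl
  rw [h1, measureReal_union hd2 MeasurableSet.of_discrete, measureReal_union hd1 MeasurableSet.of_discrete, i1, i2, i3]

/-- `μ(T ∩ F ∩ G) = κξ' + ξκ' − κκ' + κ λ_R + λ_L κ'`. [folklore] -/
theorem sep_real_TFG : (prodBernoulli w).real (openConn x a ∩ openConn x b ∩ openConn x u) =
    (prodBernoulli w).real ((({ω : BondConfig V | rB L {x, a} ω x a} : Set (BondConfig V))) ∩ (({ω : BondConfig V | rB L {x, a} ω x b} : Set (BondConfig V)))) * (prodBernoulli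
          w).real (({ω : BondConfig V | (openGraph (ω ∩ sideT L {x, a})).Reachable x u} : Set (BondConfig V))) +
      (prodBernoulli w).real (({ω : BondConfig V | rB L {x, a} ω x b} : Set (BondConfig V))) * (prodBernoulli w).real ((({ω : BondConfig V | (openGraph (ω ∩ sideT L {x,
            a})).Reachable x a} : Set (BondConfig V))) ∩ (({ω : BondConfig V | (openGraph (ω ∩ sideT L {x, a})).Reachable x u} : Set (BondConfig V)))) -
      (prodBernoulli w).real ((({ω : BondConfig V | rB L {x, a} ω x a} : Set (BondConfig V))) ∩ (({ω : BondConfig V | rB L {x, a} ω x b} : Set (BondConfig V)))) * (prodBernoulli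
            w).real ((({ω : BondConfig V | (openGraph (ω ∩ sideT L {x, a})).Reachable x a} : Set (BondConfig V))) ∩ (({ω : BondConfig V | (openGraph (ω ∩ sideT L {x,
            a})).Reachable x u} : Set (BondConfig V)))) +
      (prodBernoulli w).real ((({ω : BondConfig V | rB L {x, a} ω x a} : Set (BondConfig V))) ∩ (({ω : BondConfig V | rB L {x, a} ω x b} : Set (BondConfig V)))) * (prodBernoulli
            w).real ((({ω : BondConfig V | (openGraph (ω ∩ sideT L {x, a})).Reachable a u} : Set (BondConfig V)) ∩ ({ω : BondConfig V | (openGraph (ω ∩ sideT L {x, a})).Reachable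
            x u} : Set (BondConfig V))ᶜ)) +
      (prodBernoulli w).real ((({ω : BondConfig V | rB L {x, a} ω a b} : Set (BondConfig V)) ∩ ({ω : BondConfig V | rB L {x, a} ω x b} : Set (BondConfig V))ᶜ)) * (prodBernoulli
            w).real ((({ω : BondConfig V | (openGraph (ω ∩ sideT L {x, a})).Reachable x a} : Set (BondConfig V))) ∩ (({ω : BondConfig V | (openGraph (ω ∩ sideT L {x,
            a})).Reachable x u} : Set (BondConfig V)))) := by
  have h1 : (prodBernoulli w).real (openConn x a ∩ openConn x b ∩ openConn x u) =
      (prodBernoulli w).real ((((((({ω : BondConfig V | rB L {x, a} ω x a} : Set (BondConfig V))) ∩ (({ω : BondConfig V | rB L {x, a} ω x b} : Set (BondConfig V)))) ∩ (({ω :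
            BondConfig V | (openGraph (ω ∩ sideT L {x, a})).Reachable x u} : Set (BondConfig V)))) ∪ ((({ω : BondConfig V | rB L {x, a} ω x b} : Set (BondConfig V))) ∩ ((({ω :
            BondConfig V | (openGraph (ω ∩ sideT L {x, a})).Reachable x a} : Set (BondConfig V))) ∩ (({ω : BondConfig V | (openGraph (ω ∩ sideT L {x, a})).Reachable x u} : Set
            (BondConfig V)))))) ∪ (((({ω : BondConfig V | rB L {x, a} ω x a} : Set (BondConfig V))) ∩ (({ω : BondConfig V | rB L {x, a} ω x b} : Set (BondConfig V)))) ∩ ((({ω :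
            BondConfig V | (openGraph (ω ∩ sideT L {x, a})).Reachable a u} : Set (BondConfig V)) ∩ ({ω : BondConfig V | (openGraph (ω ∩ sideT L {x, a})).Reachable x u} : Set
            (BondConfig V))ᶜ)))) ∪ (((({ω : BondConfig V | rB L {x, a} ω a b} : Set (BondConfig V)) ∩ ({ω : BondConfig V | rB L {x, a} ω x b} : Set (BondConfig V))ᶜ)) ∩ ((({ω :
            BondConfig V | (openGraph (ω ∩ sideT L {x, a})).Reachable x a} : Set (BondConfig V))) ∩ (({ω : BondConfig V | (openGraph (ω ∩ sideT L {x, a})).Reachable x u} : Set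
            (BondConfig V)))))) :=
    sep_real_congr w fun ω hω => by
      obtain ⟨hT, hF, hG, htL, -⟩ := sep_structure w hx ha hxa hb hu hcut hω
      simp only [openConn, Set.mem_setOf_eq, Set.mem_union, Set.mem_inter_iff, Set.mem_compl_iff] at hT hF hG ⊢
      rw [hT, hF, hG]
      constructor
      · rintro ⟨⟨h0, h1 | ⟨hB, hX, hA'⟩⟩, h2 | ⟨hB', hX', hA⟩⟩
        · rcases h0 with hA | hA'
          · exact Or.inl (Or.inl (Or.inl ⟨⟨hA, h1⟩, h2⟩))
          · exact Or.inl (Or.inl (Or.inr ⟨h1, hA', h2⟩))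
        · exact Or.inl (Or.inr ⟨⟨hA, h1⟩, hB', hX'⟩)
        · exact Or.inr ⟨⟨hB, hX⟩, hA', h2⟩
        · exact absurd (htL hA hB) hX
      · rintro (((⟨⟨hA, h1⟩, h2⟩ | ⟨h1, hA', h2⟩) | ⟨⟨hA, h1⟩, hB', hX'⟩) | ⟨⟨hB, hX⟩, hA', h2⟩)
        · exact ⟨⟨Or.inl hA, Or.inl h1⟩, Or.inl h2⟩
        · exact ⟨⟨Or.inr hA', Or.inl h1⟩, Or.inl h2⟩
        · exact ⟨⟨Or.inl hA, Or.inl h1⟩, Or.inr ⟨hB', hX', hA⟩⟩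
        · exact ⟨⟨Or.inr hA', Or.inr ⟨hB, hX, hA'⟩⟩, Or.inl h2⟩
  have hd1 : Disjoint ((((({ω : BondConfig V | rB L {x, a} ω x a} : Set (BondConfig V))) ∩ (({ω : BondConfig V | rB L {x, a} ω x b} : Set (BondConfig V)))) ∩ (({ω : BondConfig V |
        (openGraph (ω ∩ sideT L {x, a})).Reachable x u} : Set (BondConfig V)))) ∪ ((({ω : BondConfig V | rB L {x, a} ω x b} : Set (BondConfig V))) ∩ ((({ω : BondConfig V |
        (openGraph (ω ∩ sideT L {x, a})).Reachable x a} : Set (BondConfig V))) ∩ (({ω : BondConfig V | (openGraph (ω ∩ sideT L {x, a})).Reachable x u} : Set (BondConfig V))))))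
        (((({ω : BondConfig V | rB L {x, a} ω x a} : Set (BondConfig V))) ∩ (({ω : BondConfig V | rB L {x, a} ω x b} : Set (BondConfig V)))) ∩ ((({ω : BondConfig V | (openGraph (ω
        ∩ sideT L {x, a})).Reachable a u} : Set (BondConfig V)) ∩ ({ω : BondConfig V | (openGraph (ω ∩ sideT L {x, a})).Reachable x u} : Set (BondConfig V))ᶜ))) :=
    Set.disjoint_left.2 fun ω h1 h2 => by
      rcases h1 with h1 | h1
      · exact h2.2.2 h1.2
      · exact h2.2.2 h1.2.2
  have hd2 : Disjoint (((((({ω : BondConfig V | rB L {x, a} ω x a} : Set (BondConfig V))) ∩ (({ω : BondConfig V | rB L {x, a} ω x b} : Set (BondConfig V)))) ∩ (({ω : BondConfig V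
        | (openGraph (ω ∩ sideT L {x, a})).Reachable x u} : Set (BondConfig V)))) ∪ ((({ω : BondConfig V | rB L {x, a} ω x b} : Set (BondConfig V))) ∩ ((({ω : BondConfig V |
        (openGraph (ω ∩ sideT L {x, a})).Reachable x a} : Set (BondConfig V))) ∩ (({ω : BondConfig V | (openGraph (ω ∩ sideT L {x, a})).Reachable x u} : Set (BondConfig V)))))) ∪
        (((({ω : BondConfig V | rB L {x, a} ω x a} : Set (BondConfig V))) ∩ (({ω : BondConfig V | rB L {x, a} ω x b} : Set (BondConfig V)))) ∩ ((({ω : BondConfig V | (openGraph (ω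
        ∩ sideT L {x, a})).Reachable a u} : Set (BondConfig V)) ∩ ({ω : BondConfig V | (openGraph (ω ∩ sideT L {x, a})).Reachable x u} : Set (BondConfig V))ᶜ)))) (((({ω :
        BondConfig V | rB L {x, a} ω a b} : Set (BondConfig V)) ∩ ({ω : BondConfig V | rB L {x, a} ω x b} : Set (BondConfig V))ᶜ)) ∩ ((({ω : BondConfig V | (openGraph (ω ∩ sideT L
        {x, a})).Reachable x a} : Set (BondConfig V))) ∩ (({ω : BondConfig V | (openGraph (ω ∩ sideT L {x, a})).Reachable x u} : Set (BondConfig V))))) :=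
    Set.disjoint_left.2 fun ω h1 h2 => by
      rcases h1 with (h1 | h1) | h1
      · exact h2.1.2 h1.1.2
      · exact h2.1.2 h1.1
      · exact h2.1.2 h1.1.2
  have h2 := measureReal_union_add_inter (μ := prodBernoulli w) (s := (((({ω : BondConfig V | rB L {x, a} ω x a} : Set (BondConfig V))) ∩ (({ω : BondConfig V | rB L {x, a} ω x b}
        : Set (BondConfig V)))) ∩ (({ω : BondConfig V | (openGraph (ω ∩ sideT L {x, a})).Reachable x u} : Set (BondConfig V))))) (t := ((({ω : BondConfig V | rB L {x, a} ω x b} :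
        Set (BondConfig V))) ∩ ((({ω : BondConfig V | (openGraph (ω ∩ sideT L {x, a})).Reachable x a} : Set (BondConfig V))) ∩ (({ω : BondConfig V | (openGraph (ω ∩ sideT L {x,
        a})).Reachable x u} : Set (BondConfig V))))))
    MeasurableSet.of_discrete
  have h3 : (((({ω : BondConfig V | rB L {x, a} ω x a} : Set (BondConfig V))) ∩ (({ω : BondConfig V | rB L {x, a} ω x b} : Set (BondConfig V)))) ∩ (({ω : BondConfig V | (openGraph
        (ω ∩ sideT L {x, a})).Reachable x u} : Set (BondConfig V)))) ∩ ((({ω : BondConfig V | rB L {x, a} ω x b} : Set (BondConfig V))) ∩ ((({ω : BondConfig V | (openGraph (ω ∩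
        sideT L {x, a})).Reachable x a} : Set (BondConfig V))) ∩ (({ω : BondConfig V | (openGraph (ω ∩ sideT L {x, a})).Reachable x u} : Set (BondConfig V))))) = ((({ω :
        BondConfig V | rB L {x, a} ω x a} : Set (BondConfig V))) ∩ (({ω : BondConfig V | rB L {x, a} ω x b} : Set (BondConfig V)))) ∩ ((({ω : BondConfig V | (openGraph (ω ∩ sideT
        L {x, a})).Reachable x a} : Set (BondConfig V))) ∩ (({ω : BondConfig V | (openGraph (ω ∩ sideT L {x, a})).Reachable x u} : Set (BondConfig V)))) := by
    ext ω; simp only [Set.mem_inter_iff]; tauto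
  have i1 := sep_indep w L x a (fun η => (openGraph η).Reachable x a ∧ (openGraph η).Reachable x b)
      (fun η => (openGraph η).Reachable x u) (S := (({ω : BondConfig V | rB L {x, a} ω x a} : Set (BondConfig V))) ∩ (({ω : BondConfig V | rB L {x, a} ω x b} : Set (BondConfig
            V)))) (S' := (({ω : BondConfig V | (openGraph (ω ∩ sideT L {x, a})).Reachable x u} : Set (BondConfig V)))) rfl rfl
  have i2 := sep_indep w L x a (fun η => (openGraph η).Reachable x b)
      (fun η => (openGraph η).Reachable x a ∧ (openGraph η).Reachable x u) (S := (({ω : BondConfig V | rB L {x, a} ω x b} : Set (BondConfig V)))) (S' := (({ω : BondConfig V |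
            (openGraph (ω ∩ sideT L {x, a})).Reachable x a} : Set (BondConfig V))) ∩ (({ω : BondConfig V | (openGraph (ω ∩ sideT L {x, a})).Reachable x u} : Set (BondConfig V))))
            rfl rfl
  have i3 := sep_indep w L x a (fun η => (openGraph η).Reachable x a ∧ (openGraph η).Reachable x b)
      (fun η => (openGraph η).Reachable x a ∧ (openGraph η).Reachable x u) (S := (({ω : BondConfig V | rB L {x, a} ω x a} : Set (BondConfig V))) ∩ (({ω : BondConfig V | rB L {x,
            a} ω x b} : Set (BondConfig V)))) (S' := (({ω : BondConfig V | (openGraph (ω ∩ sideT L {x, a})).Reachable x a} : Set (BondConfig V))) ∩ (({ω : BondConfig V |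
            (openGraph (ω ∩ sideT L {x, a})).Reachable x u} : Set (BondConfig V)))) rfl rfl
  have i4 := sep_indep w L x a (fun η => (openGraph η).Reachable x a ∧ (openGraph η).Reachable x b)
      (fun η => (openGraph η).Reachable a u ∧ ¬ (openGraph η).Reachable x u) (S := (({ω : BondConfig V | rB L {x, a} ω x a} : Set (BondConfig V))) ∩ (({ω : BondConfig V | rB L {x,
            a} ω x b} : Set (BondConfig V)))) (S' := ((({ω : BondConfig V | (openGraph (ω ∩ sideT L {x, a})).Reachable a u} : Set (BondConfig V)) ∩ ({ω : BondConfig V | (openGraph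
            (ω ∩ sideT L {x, a})).Reachable x u} : Set (BondConfig V))ᶜ))) rfl rfl
  have i5 := sep_indep w L x a (fun η => (openGraph η).Reachable a b ∧ ¬ (openGraph η).Reachable x b)
      (fun η => (openGraph η).Reachable x a ∧ (openGraph η).Reachable x u) (S := ((({ω : BondConfig V | rB L {x, a} ω a b} : Set (BondConfig V)) ∩ ({ω : BondConfig V | rB L {x, a}
            ω x b} : Set (BondConfig V))ᶜ))) (S' := (({ω : BondConfig V | (openGraph (ω ∩ sideT L {x, a})).Reachable x a} : Set (BondConfig V))) ∩ (({ω : BondConfig V | (openGraph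
            (ω ∩ sideT L {x, a})).Reachable x u} : Set (BondConfig V)))) rfl rfl
  rw [h3] at h2
  rw [h1, measureReal_union hd2 MeasurableSet.of_discrete, measureReal_union hd1 MeasurableSet.of_discrete, i4, i5]
  linarith [h2, i1, i2, i3]

omit hx ha hxa hb hu hcut in
/-- The one-side covariance in the atoms: `φ_L = κ − α(ξ + λ_L)`, i.e.
`μ(A_L ∩ (X_L ∪ B_L)) = κ` and `μ(X_L ∪ B_L) = ξ + λ_L`. [folklore] -/
theorem sep_real_sideL :
    (prodBernoulli w).real ((({ω : BondConfig V | rB L {x, a} ω x a} : Set (BondConfig V))) ∩ ((({ω : BondConfig V | rB L {x, a} ω x b} : Set (BondConfig V))) ∪ (({ω : BondConfig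
          V | rB L {x, a} ω a b} : Set (BondConfig V))))) = (prodBernoulli w).real ((({ω : BondConfig V | rB L {x, a} ω x a} : Set (BondConfig V))) ∩ (({ω : BondConfig V | rB L
          {x, a} ω x b} : Set (BondConfig V)))) ∧
    (prodBernoulli w).real ((({ω : BondConfig V | rB L {x, a} ω x b} : Set (BondConfig V))) ∪ (({ω : BondConfig V | rB L {x, a} ω a b} : Set (BondConfig V)))) = (prodBernoulli
          w).real (({ω : BondConfig V | rB L {x, a} ω x b} : Set (BondConfig V))) + (prodBernoulli w).real ((({ω : BondConfig V | rB L {x, a} ω a b} : Set (BondConfig V)) ∩ ({ω :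
          BondConfig V | rB L {x, a} ω x b} : Set (BondConfig V))ᶜ)) := by
  constructor
  · congr 1; ext ω; simp only [Set.mem_inter_iff, Set.mem_union, Set.mem_setOf_eq]
    exact ⟨fun ⟨h1, h2⟩ => ⟨h1, h2.elim id fun h => rB.trans h1 h⟩, fun ⟨h1, h2⟩ => ⟨h1, Or.inl h2⟩⟩
  · have h : ((({ω : BondConfig V | rB L {x, a} ω x b} : Set (BondConfig V))) ∪ (({ω : BondConfig V | rB L {x, a} ω a b} : Set (BondConfig V)))) = ((({ω : BondConfig V | rB L {x,
        a} ω x b} : Set (BondConfig V))) ∪ ((({ω : BondConfig V | rB L {x, a} ω a b} : Set (BondConfig V)) ∩ ({ω : BondConfig V | rB L {x, a} ω x b} : Set (BondConfig V))ᶜ))) := by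
      ext ω; simp only [Set.mem_inter_iff, Set.mem_union, Set.mem_setOf_eq, Set.mem_compl_iff]; tauto
    rw [h, measureReal_union (Set.disjoint_left.2 fun ω h1 h2 => h2.2 h1) MeasurableSet.of_discrete]

omit hx ha hxa hb hu hcut in
/-- The same on the `R`-side: `μ(A_R ∩ (X_R ∪ B_R)) = κ'`, `μ(X_R ∪ B_R) = ξ' + λ_R`. [folklore] -/
theorem sep_real_sideR :
    (prodBernoulli w).real ((({ω : BondConfig V | (openGraph (ω ∩ sideT L {x, a})).Reachable x a} : Set (BondConfig V))) ∩ ((({ω : BondConfig V | (openGraph (ω ∩ sideT L {x,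
          a})).Reachable x u} : Set (BondConfig V))) ∪ (({ω : BondConfig V | (openGraph (ω ∩ sideT L {x, a})).Reachable a u} : Set (BondConfig V))))) = (prodBernoulli w).real
          ((({ω : BondConfig V | (openGraph (ω ∩ sideT L {x, a})).Reachable x a} : Set (BondConfig V))) ∩ (({ω : BondConfig V | (openGraph (ω ∩ sideT L {x, a})).Reachable x u} :
          Set (BondConfig V)))) ∧
    (prodBernoulli w).real ((({ω : BondConfig V | (openGraph (ω ∩ sideT L {x, a})).Reachable x u} : Set (BondConfig V))) ∪ (({ω : BondConfig V | (openGraph (ω ∩ sideT L {x,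
          a})).Reachable a u} : Set (BondConfig V)))) = (prodBernoulli w).real (({ω : BondConfig V | (openGraph (ω ∩ sideT L {x, a})).Reachable x u} : Set (BondConfig V))) +
          (prodBernoulli w).real ((({ω : BondConfig V | (openGraph (ω ∩ sideT L {x, a})).Reachable a u} : Set (BondConfig V)) ∩ ({ω : BondConfig V | (openGraph (ω ∩ sideT L {x,
          a})).Reachable x u} : Set (BondConfig V))ᶜ)) := by
  constructor
  · congr 1; ext ω; simp only [Set.mem_inter_iff, Set.mem_union, Set.mem_setOf_eq]
    exact ⟨fun ⟨h1, h2⟩ => ⟨h1, h2.elim id fun h => SimpleGraph.Reachable.trans h1 h⟩, fun ⟨h1, h2⟩ => ⟨h1, Or.inl h2⟩⟩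
  · have h : ((({ω : BondConfig V | (openGraph (ω ∩ sideT L {x, a})).Reachable x u} : Set (BondConfig V))) ∪ (({ω : BondConfig V | (openGraph (ω ∩ sideT L {x, a})).Reachable a u}
        : Set (BondConfig V)))) = ((({ω : BondConfig V | (openGraph (ω ∩ sideT L {x, a})).Reachable x u} : Set (BondConfig V))) ∪ ((({ω : BondConfig V | (openGraph (ω ∩ sideT L
        {x, a})).Reachable a u} : Set (BondConfig V)) ∩ ({ω : BondConfig V | (openGraph (ω ∩ sideT L {x, a})).Reachable x u} : Set (BondConfig V))ᶜ))) := by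
      ext ω; simp only [Set.mem_inter_iff, Set.mem_union, Set.mem_setOf_eq, Set.mem_compl_iff]; tauto
    rw [h, measureReal_union (Set.disjoint_left.2 fun ω h1 h2 => h2.2 h1) MeasurableSet.of_discrete]

/-- **(I1) THE COVARIANCE IDENTITY** (PROOFS §P54 (a) (I1); BENCH l.192 M2-R54, signed mine-ref-g54).  On the separator class,
`Cov(1{x↔b}, 1{x↔u}) = λ_R·φ_L + λ_L·φ_R + λ_L·λ_R·μ(x↔a)`. [cite: VandenbergHaggstromKahn2005, Thm. 1.3 (p. 6)] -/
theorem sep_cov_eq :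
    (prodBernoulli w).real (openConn x b ∩ openConn x u) -
        (prodBernoulli w).real (openConn x b) * (prodBernoulli w).real (openConn x u) =
      (prodBernoulli w).real ((({ω : BondConfig V | (openGraph (ω ∩ sideT L {x, a})).Reachable a u} : Set (BondConfig V)) ∩ ({ω : BondConfig V | (openGraph (ω ∩ sideT L {x,
            a})).Reachable x u} : Set (BondConfig V))ᶜ)) *
          ((prodBernoulli w).real ((({ω : BondConfig V | rB L {x, a} ω x a} : Set (BondConfig V))) ∩ ((({ω : BondConfig V | rB L {x, a} ω x b} : Set (BondConfig V))) ∪ (({ω :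
                BondConfig V | rB L {x, a} ω a b} : Set (BondConfig V))))) - (prodBernoulli w).real (({ω : BondConfig V | rB L {x, a} ω x a} : Set (BondConfig V))) *
                (prodBernoulli w).real ((({ω : BondConfig V | rB L {x, a} ω x b} : Set (BondConfig V))) ∪ (({ω : BondConfig V | rB L {x, a} ω a b} : Set (BondConfig V))))) +
        (prodBernoulli w).real ((({ω : BondConfig V | rB L {x, a} ω a b} : Set (BondConfig V)) ∩ ({ω : BondConfig V | rB L {x, a} ω x b} : Set (BondConfig V))ᶜ)) *
          ((prodBernoulli w).real ((({ω : BondConfig V | (openGraph (ω ∩ sideT L {x, a})).Reachable x a} : Set (BondConfig V))) ∩ ((({ω : BondConfig V | (openGraph (ω ∩ sideT L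
                {x, a})).Reachable x u} : Set (BondConfig V))) ∪ (({ω : BondConfig V | (openGraph (ω ∩ sideT L {x, a})).Reachable a u} : Set (BondConfig V))))) - (prodBernoulli
                w).real (({ω : BondConfig V | (openGraph (ω ∩ sideT L {x, a})).Reachable x a} : Set (BondConfig V))) * (prodBernoulli w).real ((({ω : BondConfig V | (openGraph (ω
                ∩ sideT L {x, a})).Reachable x u} : Set (BondConfig V))) ∪ (({ω : BondConfig V | (openGraph (ω ∩ sideT L {x, a})).Reachable a u} : Set (BondConfig V))))) +
        (prodBernoulli w).real ((({ω : BondConfig V | rB L {x, a} ω a b} : Set (BondConfig V)) ∩ ({ω : BondConfig V | rB L {x, a} ω x b} : Set (BondConfig V))ᶜ)) * (prodBernoulli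
              w).real ((({ω : BondConfig V | (openGraph (ω ∩ sideT L {x, a})).Reachable a u} : Set (BondConfig V)) ∩ ({ω : BondConfig V | (openGraph (ω ∩ sideT L {x,
              a})).Reachable x u} : Set (BondConfig V))ᶜ)) * (prodBernoulli w).real (openConn x a) := by
  obtain ⟨hL1, hL2⟩ := sep_real_sideL w
  obtain ⟨hR1, hR2⟩ := sep_real_sideR w
  rw [sep_real_FG w hx ha hxa hb hu hcut, sep_real_F w hx ha hxa hb hu hcut, sep_real_G w hx ha hxa hb hu hcut,
    sep_real_T w hx ha hxa hb hu hcut, hL1, hL2, hR1, hR2]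
  ring

/-- **(I2) THE BRACKET IDENTITY** (PROOFS §P54 (a) (I2); BENCH l.192 M2-R54, signed mine-ref-g54).  On the separator class the
first-order one-pair bracket `M = μ(TFG) + μ(T)μ(FG) − μ(F)μ(TG) − μ(G)μ(TF)` satisfies `Cov − M = φ_L · φ_R`; hence
`1 + c = φ_Lφ_R/Cov ≥ 0` there. [cite: VandenbergHaggstromKahn2005, Thm. 1.3 (p. 6)] -/
theorem sep_cov_sub_bracket_eq :
    ((prodBernoulli w).real (openConn x b ∩ openConn x u) -
        (prodBernoulli w).real (openConn x b) * (prodBernoulli w).real (openConn x u)) -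
      ((prodBernoulli w).real (openConn x a ∩ openConn x b ∩ openConn x u) +
        (prodBernoulli w).real (openConn x a) * (prodBernoulli w).real (openConn x b ∩ openConn x u) -
        (prodBernoulli w).real (openConn x b) * (prodBernoulli w).real (openConn x a ∩ openConn x u) -
        (prodBernoulli w).real (openConn x u) * (prodBernoulli w).real (openConn x a ∩ openConn x b)) =
      ((prodBernoulli w).real ((({ω : BondConfig V | rB L {x, a} ω x a} : Set (BondConfig V))) ∩ ((({ω : BondConfig V | rB L {x, a} ω x b} : Set (BondConfig V))) ∪ (({ω :
            BondConfig V | rB L {x, a} ω a b} : Set (BondConfig V))))) - (prodBernoulli w).real (({ω : BondConfig V | rB L {x, a} ω x a} : Set (BondConfig V))) * (prodBernoulli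
            w).real ((({ω : BondConfig V | rB L {x, a} ω x b} : Set (BondConfig V))) ∪ (({ω : BondConfig V | rB L {x, a} ω a b} : Set (BondConfig V))))) *
        ((prodBernoulli w).real ((({ω : BondConfig V | (openGraph (ω ∩ sideT L {x, a})).Reachable x a} : Set (BondConfig V))) ∩ ((({ω : BondConfig V | (openGraph (ω ∩ sideT L {x,
              a})).Reachable x u} : Set (BondConfig V))) ∪ (({ω : BondConfig V | (openGraph (ω ∩ sideT L {x, a})).Reachable a u} : Set (BondConfig V))))) - (prodBernoulli w).real
              (({ω : BondConfig V | (openGraph (ω ∩ sideT L {x, a})).Reachable x a} : Set (BondConfig V))) * (prodBernoulli w).real ((({ω : BondConfig V | (openGraph (ω ∩ sideT L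
              {x, a})).Reachable x u} : Set (BondConfig V))) ∪ (({ω : BondConfig V | (openGraph (ω ∩ sideT L {x, a})).Reachable a u} : Set (BondConfig V))))) := by
  obtain ⟨hL1, hL2⟩ := sep_real_sideL w
  obtain ⟨hR1, hR2⟩ := sep_real_sideR w
  rw [sep_real_TFG w hx ha hxa hb hu hcut, sep_real_FG w hx ha hxa hb hu hcut, sep_real_TF w hx ha hxa hb hu hcut,
    sep_real_TG w hx ha hxa hb hu hcut, sep_real_F w hx ha hxa hb hu hcut, sep_real_G w hx ha hxa hb hu hcut,
    sep_real_T w hx ha hxa hb hu hcut, hL1, hL2, hR1, hR2]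
  ring

end Moments

end Summit.CriticalPhenomena.PercolationContinuityZ3.Theorems.CSH
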